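import Mathlib
import Summits.Ventures.HodgeRepro2.T5CyclotomicSubfieldDecomposition
import Summits.Ventures.HodgeRepro2.T5CyclotomicTwentyOneSextic

/-!
# A NON-CYCLIC CM FIELD WHERE THE PARITY CRITERION FAILS: `F = ℚ(ζ₁₅)^{⟨σ₄⟩} = ℚ(√−3, √5)`

Tier-5 support N2 / N3 / §G-N4.2 (seat p3, gen 81). Files 281 / 287 read the inert/split census of a CM field with
CYCLIC Galois group off the parity of `f(P/p)`; file 293 reads it, for every CM subfield of `ℚ(ζₘ)`, off the membership
`(−1) · H_F ∈ ⟨p · H_F⟩`. This file exhibits a biquadratic CM field on which the two differ — so the parity criterion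
is genuinely a cyclic-group statement and the general one is needed: inside `L = ℚ(ζ₁₅)` (degree `8`,
`Gal ≅ C₂ × C₄`) let `σ₄ : ζ ↦ ζ⁴` (order `2`) and `F := L^{⟨σ₄⟩}`; then `H_F = ⟨4⟩ = {1, 4}`, `[F : ℚ] = 4`, `F ∋ ζ₁₅⁵`
(a primitive cube root of unity) so `F` is a CM field, `F⁺ = ℚ(√5)` (not identified in kernel — `[F⁺ : ℚ] = 2`), and

* at `p = 2`: `f(P/2) = 2` (EVEN: `ord(2 · H_F) = 2` since `2² = 4 ∈ H_F`), yet `(−1) · H_F ∉ ⟨2 · H_F⟩` (`14 ∉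
  {1, 2, 4, 8}`), so the place of `F⁺` under `P` SPLITS in `F` (`census_two`) — `2` is inert in `ℚ(√5)` and the two
  primes of `F` above it have `f(P/v) = 1`;
* at `p = 11`: `f(P/11) = 2` (even again: `11² = 121 ≡ 1`), and `(−1) · H_F = 14 · H_F = 11 · H_F ∈ ⟨11 · H_F⟩`
  (`11 · 4 = 44 ≡ 14`), so the place of `F⁺` under `P` STAYS PRIME in `F` (`census_eleven`);
* hence **`not_isCyclic_gal`**: `Gal(F/ℚ)` is not cyclic — if it were, file 281's parity criterion would make the place
  above `2` non-split, contradicting `census_two`.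

§8(d): uses an L-value-free non-vanishing device: NO.
-/

open NumberField IsCyclotomicExtension.Rat Ideal IsDedekindDomain IsDedekindDomain.HeightOneSpectrum
open Summit.Ventures.HodgeRepro2.T5CyclotomicSubfieldInertiaDeg
  Summit.Ventures.HodgeRepro2.T5CyclotomicSubfieldSexticCensus
  Summit.Ventures.HodgeRepro2.T5CyclotomicSubfieldDecomposition
  Summit.Ventures.HodgeRepro2.T5CyclotomicTwentyOneSextic

namespace Summit.Ventures.HodgeRepro2.T5CyclotomicFifteenBiquadratic

section Units

/-- `4` is prime to `15`. -/
theorem coprime_four : Nat.Coprime 4 15 := by decide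

/-- The unit `4 ∈ (ℤ/15ℤ)ˣ`. -/
def u4 : (ZMod 15)ˣ := ZMod.unitOfCoprime 4 coprime_four

/-- `(u4 : ℤ/15ℤ) = 4`. -/
theorem u4_val : (u4 : ZMod 15) = 4 := by
  rw [u4, ZMod.coe_unitOfCoprime]
  rfl

/-- `4² = 16 = 1` in `(ℤ/15ℤ)ˣ`. -/
theorem u4_sq : u4 ^ 2 = 1 := by
  rw [Units.ext_iff, Units.val_pow_eq_pow_val, u4_val, Units.val_one]
  decide

/-- `u4 ≠ 1`. -/
theorem u4_ne_one : u4 ≠ 1 := by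
  intro h
  rw [Units.ext_iff, u4_val, Units.val_one] at h
  exact absurd h (by decide)

/-- `orderOf u4 = 2`. -/
theorem orderOf_u4 : orderOf u4 = 2 :=
  orderOf_eq_prime u4_sq u4_ne_one

/-- `(a · ⟨4⟩)^j = 1` in `(ℤ/15ℤ)ˣ / ⟨4⟩` iff `a^j ∈ {1, 4}`. -/
theorem mk_pow_eq_one_iff (a : (ZMod 15)ˣ) (j : ℕ) :
    (QuotientGroup.mk a : (ZMod 15)ˣ ⧸ Subgroup.zpowers u4) ^ j = 1 ↔
      (a : ZMod 15) ^ j = 1 ∨ (a : ZMod 15) ^ j = 4 := by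
  rw [← QuotientGroup.mk_pow, QuotientGroup.eq_one_iff, mem_zpowers_iff_of_sq_eq_one u4_sq,
    Units.ext_iff, Units.ext_iff, Units.val_pow_eq_pow_val, Units.val_one, u4_val]

/-- `a · ⟨4⟩ = b · ⟨4⟩` iff `a⁻¹ b ∈ {1, 4}`. -/
theorem mk_eq_mk_iff (a b : (ZMod 15)ˣ) :
    (QuotientGroup.mk a : (ZMod 15)ˣ ⧸ Subgroup.zpowers u4) = QuotientGroup.mk b ↔
      a⁻¹ * b = 1 ∨ a⁻¹ * b = u4 := by
  rw [QuotientGroup.eq, mem_zpowers_iff_of_sq_eq_one u4_sq]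

/-- **The order of `p · ⟨4⟩`** from two decidable checks (as in file 288). -/
theorem orderOf_mk_eq (p : ℕ) (hp : p.Coprime 15) (k : ℕ) (hk : 0 < k)
    (h1 : (p : ZMod 15) ^ k = 1 ∨ (p : ZMod 15) ^ k = 4)
    (h2 : ∀ j ∈ Finset.Ico 1 k, ¬ ((p : ZMod 15) ^ j = 1 ∨ (p : ZMod 15) ^ j = 4)) :
    orderOf (QuotientGroup.mk (ZMod.unitOfCoprime p hp) : (ZMod 15)ˣ ⧸ Subgroup.zpowers u4) = k := by
  rw [orderOf_eq_iff hk]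
  refine ⟨?_, ?_⟩
  · rw [mk_pow_eq_one_iff, ZMod.coe_unitOfCoprime]
    exact h1
  · intro j hjk hj h
    rw [mk_pow_eq_one_iff, ZMod.coe_unitOfCoprime] at h
    exact h2 j (Finset.mem_Ico.mpr ⟨hj, hjk⟩) h

/-- Transport of `[a] ∈ ⟨[b]⟩` along an equality of subgroups. -/
theorem mem_zpowers_mk_congr {G : Type*} [CommGroup G] {H H' : Subgroup G} (h : H = H') (a b : G) :
    ((QuotientGroup.mk a : G ⧸ H) ∈ Subgroup.zpowers (QuotientGroup.mk b)) ↔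
      ((QuotientGroup.mk a : G ⧸ H') ∈ Subgroup.zpowers (QuotientGroup.mk b)) := by
  subst h
  rfl

/-- `ord(2 · ⟨4⟩) = 2` (`2² = 4 ∈ ⟨4⟩`). -/
theorem orderOf_mk_two :
    orderOf (QuotientGroup.mk (ZMod.unitOfCoprime 2 (by decide)) :
      (ZMod 15)ˣ ⧸ Subgroup.zpowers u4) = 2 :=
  orderOf_mk_eq 2 (by decide) 2 (by norm_num) (by decide) (by decide)

/-- `ord(11 · ⟨4⟩) = 2` (`11² = 121 ≡ 1`). -/
theorem orderOf_mk_eleven :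
    orderOf (QuotientGroup.mk (ZMod.unitOfCoprime 11 (by decide)) :
      (ZMod 15)ˣ ⧸ Subgroup.zpowers u4) = 2 :=
  orderOf_mk_eq 11 (by decide) 2 (by norm_num) (by decide) (by decide)

/-- **`(−1) · ⟨4⟩ ∉ ⟨2 · ⟨4⟩⟩`**: `14 ∉ {1, 2} · {1, 4} = {1, 2, 4, 8}`. -/
theorem neg_one_notMem_zpowers_two :
    (QuotientGroup.mk (-1) : (ZMod 15)ˣ ⧸ Subgroup.zpowers u4) ∉
      Subgroup.zpowers (QuotientGroup.mk (ZMod.unitOfCoprime 2 (by decide))) := by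
  have hsq : (QuotientGroup.mk (ZMod.unitOfCoprime 2 (by decide)) :
      (ZMod 15)ˣ ⧸ Subgroup.zpowers u4) ^ 2 = 1 := by
    rw [mk_pow_eq_one_iff, ZMod.coe_unitOfCoprime]
    decide
  rw [mem_zpowers_iff_of_sq_eq_one hsq, QuotientGroup.eq_one_iff, mem_zpowers_iff_of_sq_eq_one u4_sq,
    mk_eq_mk_iff]
  decide

/-- **`(−1) · ⟨4⟩ ∈ ⟨11 · ⟨4⟩⟩`**: `11⁻¹ · 14 = 11 · 14 = 154 ≡ 4 ∈ ⟨4⟩`, so `(−1) · ⟨4⟩ = 11 · ⟨4⟩`. -/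
theorem neg_one_mem_zpowers_eleven :
    (QuotientGroup.mk (-1) : (ZMod 15)ˣ ⧸ Subgroup.zpowers u4) ∈
      Subgroup.zpowers (QuotientGroup.mk (ZMod.unitOfCoprime 11 (by decide))) := by
  have h : (QuotientGroup.mk (-1) : (ZMod 15)ˣ ⧸ Subgroup.zpowers u4) =
      QuotientGroup.mk (ZMod.unitOfCoprime 11 (by decide)) := by
    rw [mk_eq_mk_iff]
    decide
  rw [h]
  exact Subgroup.mem_zpowers _

end Units

section Field

variable (L : Type*) [Field L] [NumberField L] [IsCyclotomicExtension {15} ℚ L]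

/-- **`σ₄ : ζ ↦ ζ⁴`**, the automorphism of `ℚ(ζ₁₅)` attached to `4 ∈ (ℤ/15ℤ)ˣ`. -/
noncomputable def sigma : (L ≃ₐ[ℚ] L) := (galEquivZMod 15 L).symm u4

/-- `galEquivZMod σ₄ = 4`. -/
theorem galEquivZMod_sigma : galEquivZMod 15 L (sigma L) = u4 :=
  (galEquivZMod 15 L).apply_symm_apply u4

/-- `σ₄² = 1`. -/
theorem sigma_sq : sigma L ^ 2 = 1 := by
  rw [sigma, ← map_pow, u4_sq, map_one]

/-- `orderOf σ₄ = 2`. -/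
theorem orderOf_sigma : orderOf (sigma L) = 2 :=
  (orderOf_injective (galEquivZMod 15 L).symm.toMonoidHom (galEquivZMod 15 L).symm.injective u4).trans
    orderOf_u4

/-- **THE FIELD `F = ℚ(ζ₁₅)^{⟨σ₄⟩}`** (`= ℚ(√−3, √5)`, biquadratic CM). -/
noncomputable def fixedField : IntermediateField ℚ L :=
  IntermediateField.fixedField (Subgroup.zpowers (sigma L))

/-- `Gal(ℚ(ζ₁₅)/F) = ⟨σ₄⟩`. -/
theorem fixingSubgroup_fixedField : (fixedField L).fixingSubgroup = Subgroup.zpowers (sigma L) :=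
  IntermediateField.fixingSubgroup_fixedField _

/-- **`H_F = ⟨4⟩ ≤ (ℤ/15ℤ)ˣ`**. -/
theorem zmodSubgroup_eq : zmodSubgroup 15 L (fixedField L) = Subgroup.zpowers u4 := by
  unfold zmodSubgroup
  rw [fixingSubgroup_fixedField]
  change Subgroup.map (galEquivZMod 15 L).toMonoidHom (Subgroup.zpowers (sigma L)) = _
  rw [MonoidHom.map_zpowers]
  simp only [MulEquiv.coe_toMonoidHom]
  rw [galEquivZMod_sigma]

/-- `[ℚ(ζ₁₅) : F] = 2`. -/
theorem finrank_fixedField_top : Module.finrank (fixedField L) L = 2 := by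
  rw [fixedField, IntermediateField.finrank_fixedField_eq_card, Nat.card_zpowers, orderOf_sigma]

/-- `φ(15) = 8`. -/
theorem totient_fifteen : Nat.totient 15 = 8 := by decide

/-- `[ℚ(ζ₁₅) : ℚ] = 8`. -/
theorem finrank_cyclotomic : Module.finrank ℚ L = 8 := by
  rw [IsCyclotomicExtension.Rat.finrank 15 L, totient_fifteen]

/-- **`[F : ℚ] = 4`**. -/
theorem finrank_fixedField : Module.finrank ℚ (fixedField L) = 4 := by
  have h := Module.finrank_mul_finrank ℚ (fixedField L) L
  rw [finrank_fixedField_top, finrank_cyclotomic L] at h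
  omega

/-- `ω := ζ₁₅⁵` is a primitive cube root of unity lying in `F` (`σ₄ ω = ω⁴ = ω`). -/
theorem exists_isPrimitiveRoot_three_mem : ∃ ω : L, IsPrimitiveRoot ω 3 ∧ ω ∈ fixedField L := by
  have hζ := IsCyclotomicExtension.zeta_spec 15 ℚ L
  set ζ := IsCyclotomicExtension.zeta 15 ℚ L with hζdef
  have hω : IsPrimitiveRoot (ζ ^ 5) 3 := hζ.pow (by norm_num) (by norm_num)
  refine ⟨ζ ^ 5, hω, ?_⟩
  rw [fixedField, IntermediateField.mem_fixedField_iff]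
  intro f hf
  rw [mem_zpowers_iff_of_sq_eq_one (sigma_sq L)] at hf
  rcases hf with rfl | rfl
  · rfl
  · rw [galEquivZMod_apply_of_pow_eq 15 L (sigma L)
      (by rw [← pow_mul, mul_comm, pow_mul, hζ.pow_eq_one, one_pow]), galEquivZMod_sigma]
    have h4 : (u4 : ZMod 15).val = 4 := by rw [u4_val]; rfl
    rw [h4, show (4 : ℕ) = 3 + 1 from rfl, pow_succ, hω.pow_eq_one, one_mul]

/-- **`F` is totally complex**. -/
theorem isTotallyComplex_fixedField : IsTotallyComplex (fixedField L) := by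
  obtain ⟨ω, hω, hωF⟩ := exists_isPrimitiveRoot_three_mem L
  have hEF : IntermediateField.adjoin ℚ {ω} ≤ fixedField L := by
    rw [IntermediateField.adjoin_le_iff]
    simpa using hωF
  haveI : IsCyclotomicExtension {3} ℚ (IntermediateField.adjoin ℚ {ω}) :=
    hω.intermediateField_adjoin_isCyclotomicExtension ℚ
  haveI : IsTotallyComplex (IntermediateField.adjoin ℚ {ω}) :=
    IsCyclotomicExtension.Rat.isTotallyComplex (n := 3) _ (by norm_num)
  letI : Algebra (IntermediateField.adjoin ℚ {ω}) (fixedField L) :=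
    (IntermediateField.inclusion hEF).toRingHom.toAlgebra
  exact isTotallyComplex_of_algebra (IntermediateField.adjoin ℚ {ω}) (fixedField L)

/-- **`F` is a CM field**. -/
theorem isCMField_fixedField : IsCMField (fixedField L) :=
  haveI := isTotallyComplex_fixedField L
  isCMField_of_isTotallyComplex 15 L (fixedField L)

/-- `F` is Galois over `ℚ`. -/
theorem isGalois_fixedField : IsGalois ℚ (fixedField L) :=
  isGalois 15 L (fixedField L)

/-- `ℚ(ζ₁₅)` is a CM field. -/
theorem isCMField_cyclotomic : IsCMField L :=
  T5CyclotomicConjugation.isCMField_of_two_lt 15 L (by norm_num)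

end Field

section Census

variable (L : Type*) [Field L] [NumberField L] [IsCyclotomicExtension {15} ℚ L]

/-- **`f(P/2) = 2` in `F`** (`ord(2 · ⟨4⟩) = 2`). -/
theorem inertiaDeg_two (P : Ideal (𝓞 (fixedField L))) [P.IsPrime] [P.LiesOver (span {(2 : ℤ)})] :
    P.inertiaDeg ℤ = 2 := by
  rw [inertiaDeg_eq_orderOf_mk 15 L (fixedField L) 2 (by decide) P, orderOf_mk_congr (zmodSubgroup_eq L)]
  exact orderOf_mk_two

/-- **THE PARITY CRITERION FAILS AT `2`**: `f(P/2) = 2` is even, yet the place `v` of `F⁺` under `P` SPLITS in `F` —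
two primes of `F` above `v` (`(−1) · H_F ∉ ⟨2 · H_F⟩`, file 293). -/
theorem census_two (P : Ideal (𝓞 (fixedField L))) [P.IsPrime] [P.LiesOver (span {(2 : ℤ)})]
    (v : HeightOneSpectrum (𝓞 (maximalRealSubfield (fixedField L)))) [P.LiesOver v.asIdeal] :
    P.inertiaDeg ℤ = 2 ∧ (v.asIdeal.primesOver (𝓞 (fixedField L))).ncard = 2 := by
  haveI := isCMField_cyclotomic L
  haveI := isCMField_fixedField L
  refine ⟨inertiaDeg_two L P, ?_⟩
  rw [ncard_primesOver_eq_two_iff_notMem 15 L (fixedField L) 2 (by decide) P v,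
    mem_zpowers_mk_congr (zmodSubgroup_eq L)]
  exact neg_one_notMem_zpowers_two

/-- **`f(P/11) = 2` in `F`** (`ord(11 · ⟨4⟩) = 2`). -/
theorem inertiaDeg_eleven (P : Ideal (𝓞 (fixedField L))) [P.IsPrime] [P.LiesOver (span {(11 : ℤ)})] :
    P.inertiaDeg ℤ = 2 := by
  haveI : Fact (Nat.Prime 11) := ⟨by norm_num⟩
  rw [inertiaDeg_eq_orderOf_mk 15 L (fixedField L) 11 (by decide) P, orderOf_mk_congr (zmodSubgroup_eq L)]
  exact orderOf_mk_eleven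

/-- **AT `11` THE PLACE STAYS PRIME**: `f(P/11) = 2` and the place `v` of `F⁺` under `P` has ONE prime of `F` above it
(`(−1) · H_F = 11 · H_F ∈ ⟨11 · H_F⟩`) — the same parity as at `2`, the opposite behaviour. -/
theorem census_eleven (P : Ideal (𝓞 (fixedField L))) [P.IsPrime] [P.LiesOver (span {(11 : ℤ)})]
    (v : HeightOneSpectrum (𝓞 (maximalRealSubfield (fixedField L)))) [P.LiesOver v.asIdeal] :
    P.inertiaDeg ℤ = 2 ∧ (v.asIdeal.primesOver (𝓞 (fixedField L))).ncard = 1 ∧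
      ∃ w : HeightOneSpectrum (𝓞 (fixedField L)),
        Ideal.map (algebraMap (𝓞 (maximalRealSubfield (fixedField L))) (𝓞 (fixedField L))) v.asIdeal =
          w.asIdeal := by
  haveI := isCMField_cyclotomic L
  haveI := isCMField_fixedField L
  haveI : Fact (Nat.Prime 11) := ⟨by norm_num⟩
  refine ⟨inertiaDeg_eleven L P, ?_, ?_⟩
  · rw [ncard_primesOver_eq_one_iff_mem_zpowers' 15 L (fixedField L) 11 (by decide) P v,
      mem_zpowers_mk_congr (zmodSubgroup_eq L)]
    exact neg_one_mem_zpowers_eleven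
  · rw [exists_map_eq_iff_mem_zpowers 15 L (fixedField L) 11 (by decide) P v,
      mem_zpowers_mk_congr (zmodSubgroup_eq L)]
    exact neg_one_mem_zpowers_eleven

/-- **`Gal(F/ℚ)` IS NOT CYCLIC**: if it were, file 281's parity criterion would give ONE prime of `F` above the place
of `F⁺` under a prime `P ∣ 2` (since `f(P/2) = 2` is even), against `census_two`. -/
theorem not_isCyclic_gal : ¬ IsCyclic ((fixedField L) ≃ₐ[ℚ] (fixedField L)) := by
  intro hcyc
  haveI := isCMField_fixedField L
  haveI := isGalois_fixedField L
  haveI : (span {(2 : ℤ)}).IsMaximal := Int.ideal_span_isMaximal_of_prime 2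
  obtain ⟨P, hPmax, hP2⟩ := Ideal.exists_ideal_over_maximal_of_isIntegral (S := 𝓞 (fixedField L))
    (span {(2 : ℤ)}) (by
      rw [(RingHom.injective_iff_ker_eq_bot _).mp (algebraMap ℤ (𝓞 (fixedField L))).injective_int]
      exact bot_le)
  haveI : P.IsPrime := hPmax.isPrime
  haveI : P.LiesOver (span {(2 : ℤ)}) := ⟨hP2.symm⟩
  -- the place of `F⁺` under `P`
  have h2P : (2 : 𝓞 (fixedField L)) ∈ P := by
    have : algebraMap ℤ (𝓞 (fixedField L)) 2 ∈ P := by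
      rw [← Ideal.mem_comap, hP2]
      exact Ideal.mem_span_singleton_self _
    simpa using this
  have hne : P.under (𝓞 (maximalRealSubfield (fixedField L))) ≠ ⊥ := by
    intro h
    have h2 : (2 : 𝓞 (maximalRealSubfield (fixedField L))) ∈ P.under (𝓞 (maximalRealSubfield (fixedField L))) := by
      rw [Ideal.mem_under, map_ofNat]
      exact h2P
    rw [h, Ideal.mem_bot] at h2
    exact two_ne_zero h2
  let v : HeightOneSpectrum (𝓞 (maximalRealSubfield (fixedField L))) :=
    ⟨P.under (𝓞 (maximalRealSubfield (fixedField L))), inferInstance, hne⟩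
  haveI : P.LiesOver v.asIdeal := Ideal.over_under P
  have hc := census_two L P v
  have he : P.ramificationIdx ℤ = 1 :=
    T5CyclotomicUnramified.ramificationIdx_eq_one (m := 15) 2 L (fixedField L) (by decide) P
  have h1 := (T5CMFieldCyclicGaloisCriterion.ncard_primesOver_eq_one_iff_even_inertiaDeg (fixedField L) 2 P v
    he).mpr (by rw [hc.1]; decide)
  rw [hc.2] at h1
  exact absurd h1 (by norm_num)

end Census

end Summit.Ventures.HodgeRepro2.T5CyclotomicFifteenBiquadratic
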